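import Literature.NumberTheory.Transcendental.KZCubicalCalculus
import Mathlib.Analysis.SpecialFunctions.Trigonometric.ArctanDeriv
import Mathlib.Analysis.Calculus.MeanValue

/-!
# `StokesGeneration` (stmt-KontsevichZagierPeriods-3586) — line `fibrewise_stokes`, stub `stub_rungConeEstimate`

Registered rung stub R11 of the line `fibrewise_stokes` of the crux `StokesGeneration` (route
UnfoldedStokes): the elementary **cone estimate**
`|arctan (y tan φ) - y φ| ≤ |φ| tan² φ` for `|φ| < π/2` and `0 ≤ y ≤ 1`.
It is used on rung 4 of the line to keep the leftover loop `y ↦ Πₖ (1 + i y tan φₖ)` in the right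
half-plane (summing the estimate over the phase increments `φₖ`, `Σ φₖ = 0`).

Proof. Fix `y ∈ [0, 1]` and put `g φ := arctan (y tan φ) - y φ` on `(-π/2, π/2)`; `g 0 = 0` and
`g' s = y (1 + tan² s) / (1 + y² tan² s) - y = y (1 - y²) tan² s / (1 + y² tan² s) ∈ [0, tan² s]`.
Since `tan` is odd and strictly monotone on `(-π/2, π/2)`, `tan² s ≤ tan² φ` for `s` between `0` and
`φ`, and the mean value inequality on the segment `[0, φ]`
(`Convex.norm_image_sub_le_of_norm_hasDerivWithin_le`) gives `|g φ - g 0| ≤ tan² φ · |φ|`.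
Elementary calculus (folklore); Mathlib only.
-/

noncomputable section

-- `Summit.KontsevichZagierPeriods.KontsevichZagierPeriods.…` is the tree's mandated layout (single-conjunct summit).
set_option linter.dupNamespace false

namespace Summit.KontsevichZagierPeriods.KontsevichZagierPeriods.Cruxes.StokesGeneration.FibrewiseStokes

open MeasureTheory Set
open Literature.NumberTheory.Transcendental
open Literature.NumberTheory.Transcendental.KZ
open Literature.ModelTheory.ExponentialFields (IsSemialgebraic)

/-- **Derivative of the cone defect.** For fixed `y`, the function `s ↦ arctan (y tan s) - y s`
has derivative `1 / (1 + (y tan s)²) · (y / cos² s) - y` at every `s` with `cos s ≠ 0`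
(chain rule with `Real.hasDerivAt_tan`, `Real.hasDerivAt_arctan`). [folklore] -/
theorem rungConeEstimate_hasDerivAt (y s : ℝ) (hs : Real.cos s ≠ 0) :
    HasDerivAt (fun t => Real.arctan (y * Real.tan t) - y * t)
      (1 / (1 + (y * Real.tan s) ^ 2) * (y * (1 / Real.cos s ^ 2)) - y) s := by
  have h1 : HasDerivAt (fun t => y * Real.tan t) (y * (1 / Real.cos s ^ 2)) s :=
    (Real.hasDerivAt_tan hs).const_mul y
  have h2 : HasDerivAt (fun t => y * t) y s := by
    simpa using (hasDerivAt_id s).const_mul y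
  exact h1.arctan.sub h2

/-- **Pointwise bound on the derivative of the cone defect.** For `0 ≤ y ≤ 1` and `cos s ≠ 0`,
`0 ≤ 1 / (1 + (y tan s)²) · (y / cos² s) - y ≤ tan² s`: indeed `1 / cos² s = 1 + tan² s`, so the
derivative equals `y (1 - y²) tan² s / (1 + y² tan² s)`. [folklore] -/
theorem rungConeEstimate_deriv_bound (y s : ℝ) (hy0 : 0 ≤ y) (hy1 : y ≤ 1)
    (hs : Real.cos s ≠ 0) :
    |1 / (1 + (y * Real.tan s) ^ 2) * (y * (1 / Real.cos s ^ 2)) - y| ≤ Real.tan s ^ 2 := by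
  have hcos : 1 / Real.cos s ^ 2 = 1 + Real.tan s ^ 2 := by
    rw [one_div, ← Real.inv_one_add_tan_sq hs, inv_inv]
  rw [hcos, mul_pow]
  set t : ℝ := Real.tan s ^ 2 with ht
  have ht0 : 0 ≤ t := sq_nonneg _
  have hD : 0 < 1 + y ^ 2 * t := by positivity
  have hexpr : 1 / (1 + y ^ 2 * t) * (y * (1 + t)) - y = y * (1 - y ^ 2) * t / (1 + y ^ 2 * t) := by
    field_simp
    ring
  have hy2 : y ^ 2 ≤ 1 := by nlinarith
  rw [hexpr, abs_le]
  constructor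
  · have : 0 ≤ y * (1 - y ^ 2) * t / (1 + y ^ 2 * t) :=
      div_nonneg (mul_nonneg (mul_nonneg hy0 (sub_nonneg.mpr hy2)) ht0) hD.le
    linarith
  · rw [div_le_iff₀ hD]
    nlinarith [mul_le_mul_of_nonneg_right hy1 ht0, mul_nonneg (sq_nonneg y) (mul_nonneg ht0 ht0),
      mul_nonneg (pow_nonneg hy0 3) ht0]

/-- **Monotonicity of `tan²` away from `0`.** If `|φ| < π/2` and `s` lies between `0` and `φ`,
then `tan² s ≤ tan² φ` (`tan` is odd and strictly increasing on `(-π/2, π/2)`). [folklore] -/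
theorem rungConeEstimate_tan_sq_le {φ s : ℝ} (hφ1 : -(Real.pi / 2) < φ) (hφ2 : φ < Real.pi / 2)
    (hs : s ∈ Set.uIcc 0 φ) : Real.tan s ^ 2 ≤ Real.tan φ ^ 2 := by
  rcases le_total 0 φ with h | h
  · rw [Set.uIcc_of_le h] at hs
    obtain ⟨hs0, hsφ⟩ := hs
    have h1 : 0 ≤ Real.tan s := Real.tan_nonneg_of_nonneg_of_le_pi_div_two hs0 (by linarith)
    have h2 : Real.tan s ≤ Real.tan φ := by
      rcases eq_or_lt_of_le hsφ with heq | hlt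
      · rw [heq]
      · exact (Real.tan_lt_tan_of_lt_of_lt_pi_div_two (by linarith) hφ2 hlt).le
    nlinarith [mul_nonneg (sub_nonneg.mpr h2) (add_nonneg h1 (h1.trans h2))]
  · rw [Set.uIcc_of_ge h] at hs
    obtain ⟨hsφ, hs0⟩ := hs
    have h1 : Real.tan s ≤ 0 := Real.tan_nonpos_of_nonpos_of_neg_pi_div_two_le hs0 (by linarith)
    have h2 : Real.tan φ ≤ Real.tan s := by
      rcases eq_or_lt_of_le hsφ with heq | hlt
      · rw [heq]
      · exact (Real.tan_lt_tan_of_lt_of_lt_pi_div_two hφ1 (by linarith) hlt).le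
    nlinarith [mul_nonneg (sub_nonneg.mpr h2) (by linarith : (0 : ℝ) ≤ -Real.tan s - Real.tan φ)]

/-- **Registered stub `stub_rungConeEstimate` (rung R11): the cone estimate.** For `|φ| < π/2`
and `0 ≤ y ≤ 1`, `|arctan (y tan φ) - y φ| ≤ |φ| tan² φ`: the defect `g s = arctan (y tan s) - y s`
vanishes at `0` and has derivative `y (1 - y²) tan² s / (1 + y² tan² s) ∈ [0, tan² φ]` between `0`
and `φ` (`rungConeEstimate_hasDerivAt`, `rungConeEstimate_deriv_bound`,
`rungConeEstimate_tan_sq_le`); conclude by the mean value inequality on the segment `[0, φ]`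
(`Convex.norm_image_sub_le_of_norm_hasDerivWithin_le`). [folklore] -/
theorem stub_rungConeEstimate :
    ∀ (φ y : ℝ), |φ| < Real.pi / 2 → 0 ≤ y → y ≤ 1 →
      |Real.arctan (y * Real.tan φ) - y * φ| ≤ |φ| * Real.tan φ ^ 2 := by
  intro φ y hφ hy0 hy1
  obtain ⟨hφ1, hφ2⟩ := abs_lt.mp hφ
  -- every point between `0` and `φ` lies in `(-π/2, π/2)`
  have hIoo : ∀ s ∈ Set.uIcc 0 φ, s ∈ Set.Ioo (-(Real.pi / 2)) (Real.pi / 2) := by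
    intro s hs
    rcases Set.mem_uIcc.mp hs with ⟨h1, h2⟩ | ⟨h1, h2⟩ <;>
      exact ⟨by linarith [Real.pi_pos], by linarith [Real.pi_pos]⟩
  have hderiv : ∀ s ∈ Set.uIcc 0 φ,
      HasDerivWithinAt (fun t => Real.arctan (y * Real.tan t) - y * t)
        (1 / (1 + (y * Real.tan s) ^ 2) * (y * (1 / Real.cos s ^ 2)) - y) (Set.uIcc 0 φ) s :=
    fun s hs =>
      (rungConeEstimate_hasDerivAt y s (Real.cos_pos_of_mem_Ioo (hIoo s hs)).ne').hasDerivWithinAt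
  have hbound : ∀ s ∈ Set.uIcc 0 φ,
      ‖1 / (1 + (y * Real.tan s) ^ 2) * (y * (1 / Real.cos s ^ 2)) - y‖ ≤ Real.tan φ ^ 2 := by
    intro s hs
    rw [Real.norm_eq_abs]
    exact (rungConeEstimate_deriv_bound y s hy0 hy1 (Real.cos_pos_of_mem_Ioo (hIoo s hs)).ne').trans
      (rungConeEstimate_tan_sq_le hφ1 hφ2 hs)
  have hmv := Convex.norm_image_sub_le_of_norm_hasDerivWithin_le hderiv hbound (convex_uIcc 0 φ)
    Set.left_mem_uIcc Set.right_mem_uIcc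
  simp only [Real.tan_zero, mul_zero, Real.arctan_zero, sub_zero, Real.norm_eq_abs] at hmv
  exact hmv.trans_eq (mul_comm _ _)

end Summit.KontsevichZagierPeriods.KontsevichZagierPeriods.Cruxes.StokesGeneration.FibrewiseStokes

end
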